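import Literature.MathematicalPhysics.QuantumFieldTheory.Balaban1983to89.B6Prop22DerivMultiLevelBox
import Literature.MathematicalPhysics.QuantumFieldTheory.Balaban1983to89.B6Prop22LapMultiLevelBox
import Literature.MathematicalPhysics.QuantumFieldTheory.Balaban1983to89.B6Prop22AdjMultiLevelBox

/-!
# `Balaban1983to89.B6Prop22AllMultiLevelBox` — [B6] PROPOSITION 2.2, ENTRIES 1, 2, 3, 6 OF (2.67) WITH COMMON
CONSTANTS, FOR THE GENUINE `k`-LEVEL OPERATOR `G′ = Δ′_a^{−1}` ON A BOX (the package of files 5, 6, 7, 9 of the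
multi-level parametrix; no existing module is touched; no fact is minted)

FRAMING (verbatim cell line):
statement-level skeleton of published theorems with citation tags; proofs where landed; nothing here is a claim about the Yang–Mills mass gap

Source under audit (cell pub-balaban / lit-balaban): T. Bałaban, *Propagators and renormalization transformations for
lattice gauge theories. II*, Commun. Math. Phys. **96** (1984) 223–250 [`Balaban1984PropagatorsII`, "B6"], p. 234
[PDF 12] Proposition 2.2 (2.67) (render
`run/shared/lean/pub/pub-balaban/b2b-balaban-ref1/pages/1984-cmp96-propagators-rt-II/…-p012-x2.png`, read as an image
this generation).  Unit `lit-balaban-p21` (Phase-2 proof seat p21 gen 10), HOME `run/shared/lean/pub/lit-balaban/`,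
B6 fold owner r03, referee ref-4.

## WHAT IS PRINTED (p. 234, verbatim up to notation)

«**Proposition 2.2.** If we have (2.1), (2.2) and M is sufficiently large, then the operator G′ = Δ′_a^{−1} (a = 1)
satisfies the inequalities |(G′λ)(x)|, |(∇^η_xG′λ)(x)|, |(G′∇^{η*}λ)(x)|, ‖ζ∇^η_xG′λ‖_α, ‖ζG′∇^{η*}λ‖_α, |(Δ^ηG′λ)(x)|
≤ O(1)[(L^jη)², L^jη, L^jη, (L^jη)^{1−α}, (L^jη)^{1−α}, 1]·e^{−½δ₀d(y,y′)}|λ|, x ∈ B^j(y) …, y ∈ Λ_j,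
supp λ ⊂ B^{j′}(y′), y′ ∈ Λ_{j′}. (2.67)»

## WHAT THIS FILE CERTIFIES (kernel-checked)

`prop22_entries126_multiLevelBox`: ONE set of constants `δ₀, C, M₀ > 0`, `N₀ ≥ 1` (functions of `d`, `ℓ`, windows)
such that for every `k`, `M_h ≥ 3` with `L·M_h ≥ M₀`, `R ≥ 2L` with `RM ≥ N₀ + 1`, volume, nested family `D`
(2.1)–(2.2) and weights in the windows with `a_{i+1} = aNext ℓ a_i c_i`, the genuine `k`-level `G′ = gml` satisfies
the FIRST (`C·L^{2j}`), SECOND (`C·L^{j}`, every axis) and SIXTH (`C`) entries of (2.67) with the rate `½δ₀` in the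
realised distance `d` of `geom D` — the conjunction of `B6Prop22MultiLevelBox.prop22_first_multiLevelBox`,
`B6Prop22DerivMultiLevelBox.prop22_second_multiLevelBox`, `B6Prop22LapMultiLevelBox.prop22_sixth_multiLevelBox` at the
smallest rate and the largest thresholds/constants.  v1.1: `prop22_entries1236_multiLevelBox` adds the THIRD entry
(`C·L^{j}`, every axis; `B6Prop22AdjMultiLevelBox.prop22_third_multiLevelBox`) to the package (append-only; one import
added).

## HONEST SCOPE

Entries 4, 5 of (2.67) (the two Hölder quotients) are NOT in this package for the `k`-level operator (they are
certified for the genuine two-level operator in `B6Prop22AllTwoLevelBox`).  Otherwise as files 1–7: levels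
`1 … k`, Neumann box, `m² = 0`, `M_h ≥ 3`, lattice units, `L`-dependent (2.61)-constant, constants existential.
Nothing is inferred from the manuscript: every step is kernel-checked.
-/

namespace Literature.MathematicalPhysics.QuantumFieldTheory.Balaban1983to89.B6Prop22AllMultiLevelBox

open Matrix
open Literature.MathematicalPhysics.QuantumFieldTheory.Balaban1983to89.B4Reflection242 (boxDom)
open Literature.MathematicalPhysics.QuantumFieldTheory.Balaban1983to89.B4BoxCov237 (opBoxR)
open Literature.MathematicalPhysics.QuantumFieldTheory.Balaban1983to89.B6Ineq243TwoLevelBox (aNext)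
open Literature.MathematicalPhysics.QuantumFieldTheory.Balaban1983to89.B6MultiLevelBoxOperator
open Literature.MathematicalPhysics.QuantumFieldTheory.Balaban1983to89.B6Geom246MultiLevelBox
open Literature.MathematicalPhysics.QuantumFieldTheory.Balaban1983to89.B6Prop22MultiLevelBox
open Literature.MathematicalPhysics.QuantumFieldTheory.Balaban1983to89.B6Prop22DerivMultiLevelBox
open Literature.MathematicalPhysics.QuantumFieldTheory.Balaban1983to89.B6Prop22LapMultiLevelBox
open Literature.MathematicalPhysics.QuantumFieldTheory.Balaban1983to89.B6Prop22AdjMultiLevelBox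
open Literature.MathematicalPhysics.QuantumFieldTheory.Balaban1983to89.B6RandomWalk (HasMajorant hasMajorant_mono)

noncomputable section

variable {d : ℕ}

/-- **[B6] PROPOSITION 2.2, ENTRIES 1, 2, 6 OF (2.67) WITH COMMON CONSTANTS, FOR THE GENUINE `k`-LEVEL OPERATOR ON A
BOX.** [cite: Balaban1984PropagatorsII, Proposition 2.2 (2.67) p.234 (first, second, sixth entries)] -/
theorem prop22_entries126_multiLevelBox (d ℓ : ℕ) (hℓ : 1 ≤ ℓ) (aminus aplus a2minus a2plus : ℝ) (ha : 0 < aminus)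
    (ha2 : 0 < a2minus) :
    ∃ δ₀ C M₀ : ℝ, ∃ N₀ : ℕ, 0 < δ₀ ∧ 0 < C ∧ 0 < M₀ ∧ 0 < N₀ ∧
      ∀ (k Mh R : ℕ), 3 ≤ Mh → M₀ ≤ ((ℓ : ℝ) + 1) * Mh → 2 * (ℓ + 1) ≤ R → N₀ + 1 ≤ R * ((ℓ + 1) * Mh) →
      ∀ (P : Fin (d + 1) → ℕ) (hP : ∀ μ, 1 ≤ P μ) (D : Domains d ℓ Mh k P R) (a c : ℕ → ℝ),
        (∀ i, 1 ≤ i → aminus ≤ a i ∧ a i ≤ aplus) → (∀ i, 1 ≤ i → a2minus ≤ c i ∧ c i ≤ a2plus) →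
        (∀ i, 1 ≤ i → a (i + 1) = aNext ℓ (a i) (c i)) →
        HasMajorant (g := geom D) (blkOf D) (Matrix.toLin' (gml (N0 ℓ Mh k P) ℓ k D.lev a))
            (fun y y' => C * ((ℓ : ℝ) + 1) ^ (2 * y.1.1) * Real.exp (-(δ₀ / 2 * (geom D).dist y y')))
          ∧ (∀ μ : Fin (d + 1), HasMajorant (g := geom D) (blkOf D)
              (Matrix.toLin' (dMat (N0 ℓ Mh k P) μ * gml (N0 ℓ Mh k P) ℓ k D.lev a))
              (fun y y' => C * ((ℓ : ℝ) + 1) ^ y.1.1 * Real.exp (-(δ₀ / 2 * (geom D).dist y y'))))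
          ∧ HasMajorant (g := geom D) (blkOf D)
              (Matrix.toLin' (opBoxR 1 0 0 1 (N0 ℓ Mh k P) * gml (N0 ℓ Mh k P) ℓ k D.lev a))
              (fun y y' => C * Real.exp (-(δ₀ / 2 * (geom D).dist y y'))) := by
  obtain ⟨δ₁, C₁, M₁, N₁, hδ₁, hC₁, hM₁, hN₁, h1⟩ :=
    prop22_first_multiLevelBox d ℓ hℓ aminus aplus a2minus a2plus ha ha2
  obtain ⟨δ₂, C₂, M₂, N₂, hδ₂, hC₂, hM₂, hN₂, h2⟩ :=
    prop22_second_multiLevelBox d ℓ hℓ aminus aplus a2minus a2plus ha ha2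
  obtain ⟨δ₆, C₆, M₆, N₆, hδ₆, hC₆, hM₆, hN₆, h6⟩ :=
    prop22_sixth_multiLevelBox d ℓ hℓ aminus aplus a2minus a2plus ha ha2
  refine ⟨min δ₁ (min δ₂ δ₆), max C₁ (max C₂ C₆), max M₁ (max M₂ M₆), max N₁ (max N₂ N₆),
    lt_min hδ₁ (lt_min hδ₂ hδ₆), lt_max_of_lt_left hC₁, lt_max_of_lt_left hM₁, lt_max_of_lt_left hN₁, ?_⟩
  intro k Mh R hMh hM hR hRM P hP D a c haw hcw hac
  have hMh1 : 1 ≤ Mh := le_trans (by norm_num) hMh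
  have hdnn : ∀ y y' : (geom D).Site, 0 ≤ (geom D).dist y y' := (triangle_refl_nonneg D hMh1 hP).2.2
  have hM1' : M₁ ≤ ((ℓ : ℝ) + 1) * Mh := (le_max_left _ _).trans hM
  have hM2' : M₂ ≤ ((ℓ : ℝ) + 1) * Mh := ((le_max_left _ _).trans (le_max_right _ _)).trans hM
  have hM6' : M₆ ≤ ((ℓ : ℝ) + 1) * Mh := ((le_max_right _ _).trans (le_max_right _ _)).trans hM
  have hN1' : N₁ + 1 ≤ R * ((ℓ + 1) * Mh) := le_trans (by omega) hRM
  have hN2' : N₂ + 1 ≤ R * ((ℓ + 1) * Mh) :=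
    le_trans (by have := le_max_left N₂ N₆; have := le_max_right N₁ (max N₂ N₆); omega) hRM
  have hN6' : N₆ + 1 ≤ R * ((ℓ + 1) * Mh) :=
    le_trans (by have := le_max_right N₂ N₆; have := le_max_right N₁ (max N₂ N₆); omega) hRM
  -- the weakening of a rate/constant
  have hweak : ∀ (δ Cc : ℝ), min δ₁ (min δ₂ δ₆) ≤ δ → 0 ≤ Cc → Cc ≤ max C₁ (max C₂ C₆) →
      ∀ (p : ℝ), 0 ≤ p → ∀ y y' : (geom D).Site,
        Cc * p * Real.exp (-(δ / 2 * (geom D).dist y y'))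
          ≤ max C₁ (max C₂ C₆) * p * Real.exp (-(min δ₁ (min δ₂ δ₆) / 2 * (geom D).dist y y')) := by
    intro δ Cc hδ hC0 hCle p hp y y'
    have he : Real.exp (-(δ / 2 * (geom D).dist y y')) ≤ Real.exp (-(min δ₁ (min δ₂ δ₆) / 2 * (geom D).dist y y')) := by
      rw [Real.exp_le_exp, neg_le_neg_iff]
      exact mul_le_mul_of_nonneg_right (by linarith) (hdnn y y')
    exact mul_le_mul (mul_le_mul_of_nonneg_right hCle hp) he (Real.exp_pos _).le (by positivity)
  refine ⟨?_, fun μ => ?_, ?_⟩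
  · refine hasMajorant_mono (g := geom D) (blkOf D) (h1 k Mh R hMh hM1' hR hN1' P hP D a c haw hcw hac) fun y y' => ?_
    exact hweak δ₁ C₁ (min_le_left _ _) hC₁.le (le_max_left _ _) _ (by positivity) y y'
  · refine hasMajorant_mono (g := geom D) (blkOf D) (h2 k Mh R hMh hM2' hR hN2' P hP D a c haw hcw hac μ) fun y y' => ?_
    exact hweak δ₂ C₂ ((min_le_right _ _).trans (min_le_left _ _)) hC₂.le
      ((le_max_left _ _).trans (le_max_right _ _)) _ (by positivity) y y'
  · refine hasMajorant_mono (g := geom D) (blkOf D) (h6 k Mh R hMh hM6' hR hN6' P hP D a c haw hcw hac) fun y y' => ?_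
    have h := hweak δ₆ C₆ ((min_le_right _ _).trans (min_le_right _ _)) hC₆.le
      ((le_max_right _ _).trans (le_max_right _ _)) 1 zero_le_one y y'
    rw [mul_one, mul_one] at h
    exact h

/-- **[B6] PROPOSITION 2.2, ENTRIES 1, 2, 3, 6 OF (2.67) WITH COMMON CONSTANTS, FOR THE GENUINE `k`-LEVEL OPERATOR ON
A BOX** (v1.1: the third entry `G′∇^{η*}λ` joins the package). [cite: Balaban1984PropagatorsII, Proposition 2.2 (2.67) p.234 (first, second, third, sixth entries)] -/
theorem prop22_entries1236_multiLevelBox (d ℓ : ℕ) (hℓ : 1 ≤ ℓ) (aminus aplus a2minus a2plus : ℝ) (ha : 0 < aminus)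
    (ha2 : 0 < a2minus) :
    ∃ δ₀ C M₀ : ℝ, ∃ N₀ : ℕ, 0 < δ₀ ∧ 0 < C ∧ 0 < M₀ ∧ 0 < N₀ ∧
      ∀ (k Mh R : ℕ), 3 ≤ Mh → M₀ ≤ ((ℓ : ℝ) + 1) * Mh → 2 * (ℓ + 1) ≤ R → N₀ + 1 ≤ R * ((ℓ + 1) * Mh) →
      ∀ (P : Fin (d + 1) → ℕ) (hP : ∀ μ, 1 ≤ P μ) (D : Domains d ℓ Mh k P R) (a c : ℕ → ℝ),
        (∀ i, 1 ≤ i → aminus ≤ a i ∧ a i ≤ aplus) → (∀ i, 1 ≤ i → a2minus ≤ c i ∧ c i ≤ a2plus) →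
        (∀ i, 1 ≤ i → a (i + 1) = aNext ℓ (a i) (c i)) →
        HasMajorant (g := geom D) (blkOf D) (Matrix.toLin' (gml (N0 ℓ Mh k P) ℓ k D.lev a))
            (fun y y' => C * ((ℓ : ℝ) + 1) ^ (2 * y.1.1) * Real.exp (-(δ₀ / 2 * (geom D).dist y y')))
          ∧ (∀ μ : Fin (d + 1), HasMajorant (g := geom D) (blkOf D)
              (Matrix.toLin' (dMat (N0 ℓ Mh k P) μ * gml (N0 ℓ Mh k P) ℓ k D.lev a))
              (fun y y' => C * ((ℓ : ℝ) + 1) ^ y.1.1 * Real.exp (-(δ₀ / 2 * (geom D).dist y y'))))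
          ∧ (∀ μ : Fin (d + 1), HasMajorant (g := geom D) (blkOf D)
              (Matrix.toLin' (gml (N0 ℓ Mh k P) ℓ k D.lev a * (dMat (N0 ℓ Mh k P) μ)ᵀ))
              (fun y y' => C * ((ℓ : ℝ) + 1) ^ y.1.1 * Real.exp (-(δ₀ / 2 * (geom D).dist y y'))))
          ∧ HasMajorant (g := geom D) (blkOf D)
              (Matrix.toLin' (opBoxR 1 0 0 1 (N0 ℓ Mh k P) * gml (N0 ℓ Mh k P) ℓ k D.lev a))
              (fun y y' => C * Real.exp (-(δ₀ / 2 * (geom D).dist y y'))) := by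
  obtain ⟨δ₁, C₁, M₁, N₁, hδ₁, hC₁, hM₁, hN₁, h1⟩ :=
    prop22_entries126_multiLevelBox d ℓ hℓ aminus aplus a2minus a2plus ha ha2
  obtain ⟨δ₃, C₃, M₃, N₃, hδ₃, hC₃, hM₃, hN₃, h3⟩ :=
    prop22_third_multiLevelBox d ℓ hℓ aminus aplus a2minus a2plus ha ha2
  refine ⟨min δ₁ δ₃, max C₁ C₃, max M₁ M₃, max N₁ N₃, lt_min hδ₁ hδ₃, lt_max_of_lt_left hC₁,
    lt_max_of_lt_left hM₁, lt_max_of_lt_left hN₁, ?_⟩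
  intro k Mh R hMh hM hR hRM P hP D a c haw hcw hac
  have hMh1 : 1 ≤ Mh := le_trans (by norm_num) hMh
  have hdnn : ∀ y y' : (geom D).Site, 0 ≤ (geom D).dist y y' := (triangle_refl_nonneg D hMh1 hP).2.2
  have hM1' : M₁ ≤ ((ℓ : ℝ) + 1) * Mh := (le_max_left _ _).trans hM
  have hM3' : M₃ ≤ ((ℓ : ℝ) + 1) * Mh := (le_max_right _ _).trans hM
  have hN1' : N₁ + 1 ≤ R * ((ℓ + 1) * Mh) := le_trans (by omega) hRM
  have hN3' : N₃ + 1 ≤ R * ((ℓ + 1) * Mh) := le_trans (by have := le_max_right N₁ N₃; omega) hRM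
  have hweak : ∀ (δ Cc : ℝ), min δ₁ δ₃ ≤ δ → 0 ≤ Cc → Cc ≤ max C₁ C₃ →
      ∀ (p : ℝ), 0 ≤ p → ∀ y y' : (geom D).Site,
        Cc * p * Real.exp (-(δ / 2 * (geom D).dist y y'))
          ≤ max C₁ C₃ * p * Real.exp (-(min δ₁ δ₃ / 2 * (geom D).dist y y')) := by
    intro δ Cc hδ hC0 hCle p hp y y'
    have he : Real.exp (-(δ / 2 * (geom D).dist y y')) ≤ Real.exp (-(min δ₁ δ₃ / 2 * (geom D).dist y y')) := by
      rw [Real.exp_le_exp, neg_le_neg_iff]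
      exact mul_le_mul_of_nonneg_right (by linarith) (hdnn y y')
    exact mul_le_mul (mul_le_mul_of_nonneg_right hCle hp) he (Real.exp_pos _).le (by positivity)
  obtain ⟨h11, h12, h16⟩ := h1 k Mh R hMh hM1' hR hN1' P hP D a c haw hcw hac
  refine ⟨?_, fun μ => ?_, fun μ => ?_, ?_⟩
  · refine hasMajorant_mono (g := geom D) (blkOf D) h11 fun y y' => ?_
    exact hweak δ₁ C₁ (min_le_left _ _) hC₁.le (le_max_left _ _) _ (by positivity) y y'
  · refine hasMajorant_mono (g := geom D) (blkOf D) (h12 μ) fun y y' => ?_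
    exact hweak δ₁ C₁ (min_le_left _ _) hC₁.le (le_max_left _ _) _ (by positivity) y y'
  · refine hasMajorant_mono (g := geom D) (blkOf D) (h3 k Mh R hMh hM3' hR hN3' P hP D a c haw hcw hac μ)
      fun y y' => ?_
    exact hweak δ₃ C₃ (min_le_right _ _) hC₃.le (le_max_right _ _) _ (by positivity) y y'
  · refine hasMajorant_mono (g := geom D) (blkOf D) h16 fun y y' => ?_
    have h := hweak δ₁ C₁ (min_le_left _ _) hC₁.le (le_max_left _ _) 1 zero_le_one y y'
    rw [mul_one, mul_one] at h
    exact h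

end

end Literature.MathematicalPhysics.QuantumFieldTheory.Balaban1983to89.B6Prop22AllMultiLevelBox
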